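import Summits.CriticalPhenomena.PercolationContinuityZ3.Theorems.Transplant.KNCells2ChainBandR
import HarnessLib

/-!
# The PLANAR SCHEDULE of a target chain (pure `Site 2`; DPRIME-SCOPE p3 addendum M, rulings R1/R2 2026-08-21T05:09:29Z, p5-g6's ask
# 05:05:52Z/05:12:22Z): per step `k ≤ N` a core box `Icc (lo k) (hi k)`, a region, an axis `ax k`, band spreads `Wb k`, one prism holding
# every region, and the ROUTE property — from every point of the `R'`-enlarged core an extent `ℓ ∈ [ℓ₀, ℓ₁]` and a sign `σ` such that the band
# rectangle `v + [−ℓ, ℓ] × [−Wb k ℓ, Wb k ℓ]` (along `ax k`) lies in `region k` and a `τ`-half of its `σ`-side lies in the next core — so that the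
# window chain (`SkelPhiWinChainS`), its kits and the route datum (`SkelPhiRouteDatum`) are typed ONCE; instances: the straight band run
# `ChainPlanar.Band.schedule` / rooted `Band.scheduleR` (here), the localisation rounds `ChainPlanar.Loc.schedule` (p5-g6)

builds on p205010 (kernel theorem, internal audit signed; external expert review pending) — nothing in this file uses p205010.
Lane `prim-bschramm`, seat `prim-bschramm-p1` (gen 9; LEVEL 1 (b) owner per R1); helper file (`--supports stmt-CriticalPhenomena-4575 --as helper`).
* §1 **`ChainPlanar.Schedule`** (data `ax lo hi region prism N R' ℓ₀ ℓ₁ Wb`; facts `encl succ sub_prism nonempty route`), `Schedule.core/level`,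
  `level_zero`, `level_mono`, `level_subset_region`, `route_level`;
* §2 **`Band.schedule`** (regions `Band.region`), **`Band.scheduleR`** (rooted regions `Band.regionR`) with their `rfl` unfoldings.
[cite: KozmaNitzan2024, §4 Lemma 11 (pp. 22–23), Lemma 12 (pp. 23–25)]
-/

noncomputable section

namespace Summit.CriticalPhenomena.PercolationContinuityZ3.Theorems

namespace Transplant

namespace ChainPlanar

open Literature.Probability.Percolation Literature.Probability.LatticeModels
open Literature.Probability.Percolation.KozmaNitzan
open Literature.Probability.Percolation.KozmaNitzan.Cells (oth oth_ne eq_oth_of_ne)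

/-! ## §1 Schedules -/

/-- **A planar schedule of `N + 1` target steps**: step `k` has the core box `Icc (lo k) (hi k)`, the region `region k ⊆ prism`, the axis
`ax k` and band spreads `Wb k`; the `R'`-enlarged core and the next core lie in the region, every core is nonempty, and (ROUTE) from every
point `v` of the `R'`-enlarged core there are an extent `ℓ ∈ [ℓ₀, ℓ₁]` and a sign `σ = ±1` such that the band rectangle
`{|y_a − v_a| ≤ ℓ, |y_{a'} − v_{a'}| ≤ Wb k ℓ}` (`a = ax k`) lies in `region k` and, for a sign `τ`, the `τ`-half of its `σ`-side lies in the
next core. [cite: KozmaNitzan2024, §4 Lemma 11 (pp. 22–23), Lemma 12 (pp. 23–25)] -/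
structure Schedule where
  /-- the axis of step `k` -/
  ax : ℕ → Fin 2
  /-- lower corner of core `k` -/
  lo : ℕ → Site 2
  /-- upper corner of core `k` -/
  hi : ℕ → Site 2
  /-- the region of step `k` -/
  region : ℕ → Finset (Site 2)
  /-- one planar box holding every region -/
  prism : Finset (Site 2)
  /-- the steps are `0, …, N` -/
  N : ℕ
  /-- the planar neighbourhood radius (level depth `+ 1`, kit-centre displacement) -/
  R' : ℕ
  /-- the minimal route extent -/
  ℓ₀ : ℕ
  /-- the maximal route extent -/
  ℓ₁ : ℕ
  /-- the band spread of step `k` at extent `ℓ` -/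
  Wb : ℕ → ℕ → ℕ
  /-- the `R'`-enlarged core lies in the region -/
  encl : ∀ k ≤ N, Finset.Icc (lo k - ((R' : ℕ) : Site 2)) (hi k + ((R' : ℕ) : Site 2)) ⊆ region k
  /-- the next core lies in the region -/
  succ : ∀ k ≤ N, Finset.Icc (lo (k + 1)) (hi (k + 1)) ⊆ region k
  /-- every region lies in the prism -/
  sub_prism : ∀ k ≤ N, region k ⊆ prism
  /-- every core is nonempty -/
  nonempty : ∀ k ≤ N + 1, (Finset.Icc (lo k) (hi k)).Nonempty
  /-- the route property -/
  route : ∀ k ≤ N, ∀ v ∈ Finset.Icc (lo k - ((R' : ℕ) : Site 2)) (hi k + ((R' : ℕ) : Site 2)), ∃ ℓ : ℕ, ℓ₀ ≤ ℓ ∧ ℓ ≤ ℓ₁ ∧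
    ∃ σ : ℤ, (σ = 1 ∨ σ = -1) ∧
      (∀ y : Site 2, |y (ax k) - v (ax k)| ≤ ℓ → |y (oth (ax k)) - v (oth (ax k))| ≤ Wb k ℓ → y ∈ region k) ∧
      ∃ τ : ℤ, (τ = 1 ∨ τ = -1) ∧ ∀ y : Site 2, y (ax k) - v (ax k) = σ * ℓ → 0 ≤ τ * (y (oth (ax k)) - v (oth (ax k))) →
        |y (oth (ax k)) - v (oth (ax k))| ≤ Wb k ℓ → y ∈ Finset.Icc (lo (k + 1)) (hi (k + 1))

namespace Schedule

variable (S : Schedule)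

/-- Core `k` of the schedule. [folklore] -/
def core (k : ℕ) : Finset (Site 2) := Finset.Icc (S.lo k) (S.hi k)

/-- Level `j` of step `k`: the `j`-enlargement of core `k`. [cite: KozmaNitzan2024, §4 p. 15 (B⟨j⟩)] -/
def level (k j : ℕ) : Finset (Site 2) := Finset.Icc (S.lo k - ((j : ℕ) : Site 2)) (S.hi k + ((j : ℕ) : Site 2))

/-- Level `0` is the core. [folklore] -/
theorem level_zero (k : ℕ) : S.level k 0 = S.core k := by
  simp [level, core]

/-- Levels grow. [folklore] -/
theorem level_mono (k : ℕ) {j j' : ℕ} (h : j ≤ j') : S.level k j ⊆ S.level k j' := by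
  refine Finset.Icc_subset_Icc (fun i => ?_) (fun i => ?_) <;>
    simp only [Pi.sub_apply, Pi.add_apply, Pi.natCast_apply] <;> omega

/-- Levels `j ≤ R'` of step `k ≤ N` lie in the region. [cite: KozmaNitzan2024, §4 Lemma 10 (p. 17: B⟨R+1⟩ ⊆ D)] -/
theorem level_subset_region {k : ℕ} (hk : k ≤ S.N) {j : ℕ} (hj : j ≤ S.R') : S.level k j ⊆ S.region k :=
  (S.level_mono k hj).trans (S.encl k hk)

/-- The next core lies in the region. [folklore] -/
theorem core_succ_subset_region {k : ℕ} (hk : k ≤ S.N) : S.core (k + 1) ⊆ S.region k := S.succ k hk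

/-- Every core is nonempty. [folklore] -/
theorem core_nonempty {k : ℕ} (hk : k ≤ S.N + 1) : (S.core k).Nonempty := S.nonempty k hk

/-- **The route property from every point of a level `j ≤ R'`.** [cite: KozmaNitzan2024, §4 Lemma 11 (pp. 22–23)] -/
theorem route_level {k : ℕ} (hk : k ≤ S.N) {j : ℕ} (hj : j ≤ S.R') {v : Site 2} (hv : v ∈ S.level k j) :
    ∃ ℓ : ℕ, S.ℓ₀ ≤ ℓ ∧ ℓ ≤ S.ℓ₁ ∧ ∃ σ : ℤ, (σ = 1 ∨ σ = -1) ∧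
      (∀ y : Site 2, |y (S.ax k) - v (S.ax k)| ≤ ℓ → |y (oth (S.ax k)) - v (oth (S.ax k))| ≤ S.Wb k ℓ → y ∈ S.region k) ∧
      ∃ τ : ℤ, (τ = 1 ∨ τ = -1) ∧ ∀ y : Site 2, y (S.ax k) - v (S.ax k) = σ * ℓ → 0 ≤ τ * (y (oth (S.ax k)) - v (oth (S.ax k))) →
        |y (oth (S.ax k)) - v (oth (S.ax k))| ≤ S.Wb k ℓ → y ∈ S.core (k + 1) :=
  S.route k hk v (S.level_mono k hj hv)

end Schedule

/-! ## §2 The band run as a schedule -/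

namespace Band

variable {q q' s₁ ρ : ℤ} {R' N WM ℓ₀ : ℕ} {Wb : ℕ → ℕ} (a : Fin 2) {σ : ℤ} (hσ : σ = 1 ∨ σ = -1) (c : Site 2)
  (h : BandOK q q' s₁ ρ R' ℓ₀ N WM Wb) {ℓ₁ : ℕ} (hℓ₁ : 2 * q + s₁ + R' ≤ ℓ₁)

/-- **The straight band run as a schedule** (cores `Band.core`, regions `Band.region`, constant axis `a` and sign `σ`, extents `≤ ℓ₁` for any
`ℓ₁ ≥ 2q + s₁ + R'`). [cite: KozmaNitzan2024, §4 Lemma 11 (pp. 22–23)] -/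
def schedule : Schedule where
  ax := fun _ => a
  lo := fun k => sLo a σ c (Adv.coreα q s₁ k) (Adv.coreβ q s₁ k) (coreW q' R' WM k)
  hi := fun k => sHi a σ c (Adv.coreα q s₁ k) (Adv.coreβ q s₁ k) (coreW q' R' WM k)
  region := region q s₁ ρ a σ c
  prism := sBox a σ c (-ρ) (q + ((N : ℤ) + 1) * s₁) ρ
  N := N
  R' := R'
  ℓ₀ := ℓ₀
  ℓ₁ := ℓ₁
  Wb := fun _ => Wb
  encl k hk := by
    rw [sBox_enlarge a σ hσ]
    exact enlarge_core_subset_region hσ c h hk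
  succ k hk := core_succ_subset_region hσ c h hk
  sub_prism k hk := region_subset_prism hσ c h hk
  nonempty k _ := core_nonempty hσ c h k
  route k hk v hv := by
    rw [sBox_enlarge a σ hσ] at hv
    obtain ⟨ℓ, h0, h1, -, hrect, τ, hτ, hhalf⟩ := core_route hσ c h hk hv
    have h1' : ℓ ≤ ℓ₁ := by
      have : (ℓ : ℤ) ≤ ℓ₁ := h1.trans hℓ₁
      exact_mod_cast this
    exact ⟨ℓ, h0, h1', σ, hσ, hrect, τ, hτ, hhalf⟩

/-- The cores of the band schedule are the band cores. [folklore] -/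
@[simp] theorem schedule_core (k : ℕ) : (schedule a hσ c h hℓ₁).core k = core q q' s₁ R' WM a σ c k := rfl

/-- The regions of the band schedule. [folklore] -/
@[simp] theorem schedule_region : (schedule a hσ c h hℓ₁).region = region q s₁ ρ a σ c := rfl

/-- The axis of the band schedule. [folklore] -/
@[simp] theorem schedule_ax (k : ℕ) : (schedule a hσ c h hℓ₁).ax k = a := rfl

/-- The band spread of the band schedule. [folklore] -/
@[simp] theorem schedule_Wb (k : ℕ) : (schedule a hσ c h hℓ₁).Wb k = Wb := rfl

/-- The parameters of the band schedule. [folklore] -/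
theorem schedule_params : (schedule a hσ c h hℓ₁).N = N ∧ (schedule a hσ c h hℓ₁).R' = R' ∧ (schedule a hσ c h hℓ₁).ℓ₀ = ℓ₀ ∧
    (schedule a hσ c h hℓ₁).ℓ₁ = ℓ₁ ∧ (schedule a hσ c h hℓ₁).prism = sBox a σ c (-ρ) (q + ((N : ℤ) + 1) * s₁) ρ :=
  ⟨rfl, rfl, rfl, rfl, rfl⟩

/-- **The rooted band run as a schedule** (regions `Band.regionR`: region `0` reaches only `ρ₀ = 3q + s₁ + 2R'` below the start box).
[cite: KozmaNitzan2024, §4 Lemma 11 (pp. 22–23)] -/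
def scheduleR : Schedule where
  ax := fun _ => a
  lo := fun k => sLo a σ c (Adv.coreα q s₁ k) (Adv.coreβ q s₁ k) (coreW q' R' WM k)
  hi := fun k => sHi a σ c (Adv.coreα q s₁ k) (Adv.coreβ q s₁ k) (coreW q' R' WM k)
  region := regionR q s₁ ρ R' a σ c
  prism := sBox a σ c (-(Adv.ρ₀ q s₁ R')) (q + ((N : ℤ) + 1) * s₁) ρ
  N := N
  R' := R'
  ℓ₀ := ℓ₀
  ℓ₁ := ℓ₁
  Wb := fun _ => Wb
  encl k hk := by
    rw [sBox_enlarge a σ hσ]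
    exact enlarge_core_subset_regionR hσ c h hk
  succ k hk := core_succ_subset_regionR hσ c h hk
  sub_prism k hk := regionR_subset_prism hσ c h hk
  nonempty k _ := core_nonempty hσ c h k
  route k hk v hv := by
    rw [sBox_enlarge a σ hσ] at hv
    obtain ⟨ℓ, h0, h1, -, hrect, τ, hτ, hhalf⟩ := core_routeR hσ c h hk hv
    have h1' : ℓ ≤ ℓ₁ := by
      have : (ℓ : ℤ) ≤ ℓ₁ := h1.trans hℓ₁
      exact_mod_cast this
    exact ⟨ℓ, h0, h1', σ, hσ, hrect, τ, hτ, hhalf⟩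

/-- The cores of the rooted band schedule are the band cores. [folklore] -/
@[simp] theorem scheduleR_core (k : ℕ) : (scheduleR a hσ c h hℓ₁).core k = core q q' s₁ R' WM a σ c k := rfl

/-- The regions of the rooted band schedule. [folklore] -/
@[simp] theorem scheduleR_region : (scheduleR a hσ c h hℓ₁).region = regionR q s₁ ρ R' a σ c := rfl

/-- The axis of the rooted band schedule. [folklore] -/
@[simp] theorem scheduleR_ax (k : ℕ) : (scheduleR a hσ c h hℓ₁).ax k = a := rfl

/-- The band spread of the rooted band schedule. [folklore] -/
@[simp] theorem scheduleR_Wb (k : ℕ) : (scheduleR a hσ c h hℓ₁).Wb k = Wb := rfl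

/-- The parameters of the rooted band schedule. [folklore] -/
theorem scheduleR_params : (scheduleR a hσ c h hℓ₁).N = N ∧ (scheduleR a hσ c h hℓ₁).R' = R' ∧ (scheduleR a hσ c h hℓ₁).ℓ₀ = ℓ₀ ∧
    (scheduleR a hσ c h hℓ₁).ℓ₁ = ℓ₁ ∧ (scheduleR a hσ c h hℓ₁).prism = sBox a σ c (-(Adv.ρ₀ q s₁ R')) (q + ((N : ℤ) + 1) * s₁) ρ :=
  ⟨rfl, rfl, rfl, rfl, rfl⟩

/-- **The first core of both band schedules is the start box** `{|level| ≤ q, |trans| ≤ q'}`. [folklore] -/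
theorem schedule_core_zero : (schedule a hσ c h hℓ₁).core 0 = sBox a σ c (-q) q q' ∧ (scheduleR a hσ c h hℓ₁).core 0 = sBox a σ c (-q) q q' := by
  rw [schedule_core, scheduleR_core]
  exact ⟨(core_zero_last (q := q) (q' := q') (s₁ := s₁) (R' := R') (N := N) (WM := WM) (a := a) (σ := σ) (c := c)).1,
    (core_zero_last (q := q) (q' := q') (s₁ := s₁) (R' := R') (N := N) (WM := WM) (a := a) (σ := σ) (c := c)).1⟩

/-- **The last core of both band schedules is the far line core** `{level = q + (N+1) s₁, |trans| ≤ w₁ + N·R'}`. [folklore] -/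
theorem schedule_core_last : (schedule a hσ c h hℓ₁).core (N + 1) =
      sBox a σ c (q + ((N : ℤ) + 1) * s₁) (q + ((N : ℤ) + 1) * s₁) (w₁ q' R' WM + (N : ℤ) * R') ∧
    (scheduleR a hσ c h hℓ₁).core (N + 1) = sBox a σ c (q + ((N : ℤ) + 1) * s₁) (q + ((N : ℤ) + 1) * s₁) (w₁ q' R' WM + (N : ℤ) * R') := by
  rw [schedule_core, scheduleR_core]
  exact ⟨(core_zero_last (q := q) (q' := q') (s₁ := s₁) (R' := R') (N := N) (WM := WM) (a := a) (σ := σ) (c := c)).2,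
    (core_zero_last (q := q) (q' := q') (s₁ := s₁) (R' := R') (N := N) (WM := WM) (a := a) (σ := σ) (c := c)).2⟩

end Band

end ChainPlanar

end Transplant

end Summit.CriticalPhenomena.PercolationContinuityZ3.Theorems

end
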